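import Mathlib.Analysis.Matrix.Order
import Mathlib.LinearAlgebra.Matrix.SchurComplement
import HarnessLib

/-!
# Rank-one downdates of positive definite matrices

`Literature/LinearAlgebra/Matrix/`. For a positive definite complex matrix `C` and a vector `a`,
the rank-one downdate `C - a a*` satisfies

* `det_sub_vecMulVec` — the matrix determinant lemma `det (C - a a*) = det C · (1 - a* C⁻¹ a)`;
* `posDef_sub_vecMulVec_iff` — `C - a a*` is positive definite iff `a* C⁻¹ a < 1` (Schur
  complements of the bordered matrix `[[C, a], [a*, 1]]`), and a positive definite downdate forces
  `C` itself to be positive definite (`posDef_of_posDef_sub_vecMulVec`);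

together with the bookkeeping for the "Gram complement" `1 - ∑ⱼ aⱼ aⱼ*` of a tuple of vectors
(`oneSubGram`), which loses the rank-one term `a a*` when a vector is appended
(`oneSubGram_snoc`). These identities drive the column-by-column computation of the law of a
corner of a Haar unitary (`det (1 - A A*)` for `A = [A', a]`). All [folklore].
-/

noncomputable section

open Matrix
open scoped ComplexOrder

namespace Literature.LinearAlgebra.Matrix

variable {n : Type*} [Fintype n] [DecidableEq n]

/-! ### The quadratic form `a* C⁻¹ a` -/

omit [DecidableEq n] in
/-- For positive semidefinite `M`, `a* M a` is a nonnegative real number. [folklore] -/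
theorem star_dotProduct_mulVec_nonneg {M : Matrix n n ℂ} (hM : M.PosSemidef) (a : n → ℂ) :
    0 ≤ (star a ⬝ᵥ M *ᵥ a).re ∧ (star a ⬝ᵥ M *ᵥ a).im = 0 := by
  have h := hM.dotProduct_mulVec_nonneg a
  rw [Complex.nonneg_iff] at h
  exact ⟨h.1, h.2.symm⟩

omit [DecidableEq n] in
/-- For positive semidefinite `M`, `a* M a` equals its real part. [folklore] -/
theorem star_dotProduct_mulVec_eq_re {M : Matrix n n ℂ} (hM : M.PosSemidef) (a : n → ℂ) :
    star a ⬝ᵥ M *ᵥ a = ((star a ⬝ᵥ M *ᵥ a).re : ℂ) := by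
  apply Complex.ext
  · simp
  · simp [(star_dotProduct_mulVec_nonneg hM a).2]

/-- The determinant of a positive definite matrix is a positive real number. [folklore] -/
theorem det_re_pos_of_posDef {C : Matrix n n ℂ} (hC : C.PosDef) :
    0 < C.det.re ∧ C.det.im = 0 := by
  have h := hC.det_pos
  rw [Complex.pos_iff] at h
  exact ⟨h.1, h.2.symm⟩

/-- The determinant of a positive definite matrix equals its (positive) real part. [folklore] -/
theorem det_eq_re_of_posDef {C : Matrix n n ℂ} (hC : C.PosDef) : C.det = (C.det.re : ℂ) := by
  apply Complex.ext
  · simp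
  · simp [(det_re_pos_of_posDef hC).2]

/-! ### The matrix determinant lemma for a downdate -/

/-- **Matrix determinant lemma** for a rank-one downdate of an invertible matrix:
`det (C - a a*) = det C · (1 - a* C⁻¹ a)`. [folklore] -/
theorem det_sub_vecMulVec {C : Matrix n n ℂ} (hC : IsUnit C.det) (a : n → ℂ) :
    (C - vecMulVec a (star a)).det = C.det * (1 - star a ⬝ᵥ C⁻¹ *ᵥ a) := by
  have h := det_add_replicateCol_mul_replicateRow (ι := Unit) hC (-a) (star a)
  rw [← vecMulVec_eq, show C + vecMulVec (-a) (star a) = C - vecMulVec a (star a) by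
    ext i j; simp [vecMulVec_apply, sub_eq_add_neg]] at h
  rw [h]
  congr 1
  rw [det_unique, Matrix.add_apply, Matrix.one_apply_eq, ← Matrix.replicateRow_vecMul,
    Matrix.replicateRow_mul_replicateCol_apply, ← dotProduct_mulVec, mulVec_neg, dotProduct_neg,
    sub_eq_add_neg]

/-! ### Positivity of a downdate -/

/-- A `1 × 1` Hermitian matrix with nonnegative entry is positive semidefinite. [folklore] -/
theorem posSemidef_of_unique {ι : Type*} [Unique ι] [Fintype ι] [DecidableEq ι] {M : Matrix ι ι ℂ}
    (h0 : 0 ≤ M default default) : M.PosSemidef := by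
  have hM : M = diagonal fun _ => M default default := by
    ext i j
    rw [Subsingleton.elim i default, Subsingleton.elim j default, diagonal_apply_eq]
  rw [hM]
  exact PosSemidef.diagonal fun _ => h0

/-- The entry of a positive semidefinite `1 × 1` matrix is nonnegative. [folklore] -/
theorem nonneg_of_posSemidef_unique {ι : Type*} [Unique ι] [Fintype ι] [DecidableEq ι]
    {M : Matrix ι ι ℂ} (hM : M.PosSemidef) : 0 ≤ M default default := by
  have h := hM.dotProduct_mulVec_nonneg (Pi.single default 1)
  simpa [dotProduct, mulVec, Fintype.sum_unique, Pi.single_apply] using h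

/-- **Positivity of a rank-one downdate.** For positive definite `C`,
`C - a a*` is positive semidefinite iff `a* C⁻¹ a ≤ 1` — both are equivalent to positive
semidefiniteness of the bordered matrix `[[C, a], [a*, 1]]`, by the two Schur complements
(`Matrix.PosDef.fromBlocks₁₁`, `Matrix.PosDef.fromBlocks₂₂`). [folklore] -/
theorem posSemidef_sub_vecMulVec_iff {C : Matrix n n ℂ} (hC : C.PosDef) (a : n → ℂ) :
    (C - vecMulVec a (star a)).PosSemidef ↔ (star a ⬝ᵥ C⁻¹ *ᵥ a).re ≤ 1 := by
  letI : Invertible C := hC.isUnit.invertible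
  have h1 : (1 : Matrix Unit Unit ℂ).PosDef := PosDef.one
  letI : Invertible (1 : Matrix Unit Unit ℂ) := invertibleOne
  -- the bordered matrix and its two Schur complements
  have hS₂ := PosDef.fromBlocks₂₂ C (replicateCol Unit a) h1
  have hS₁ := PosDef.fromBlocks₁₁ (replicateCol Unit a) (1 : Matrix Unit Unit ℂ) hC
  have hcol : replicateCol Unit a * (1 : Matrix Unit Unit ℂ)⁻¹ * (replicateCol Unit a)ᴴ =
      vecMulVec a (star a) := by
    rw [inv_one, Matrix.mul_one, conjTranspose_replicateCol, ← vecMulVec_eq]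
  rw [hcol] at hS₂
  rw [← hS₂, hS₁]
  -- the `1 × 1` Schur complement `1 - a* C⁻¹ a`
  have hentry : ((1 : Matrix Unit Unit ℂ) - (replicateCol Unit a)ᴴ * C⁻¹ * replicateCol Unit a)
      default default = 1 - star a ⬝ᵥ C⁻¹ *ᵥ a := by
    rw [conjTranspose_replicateCol, Matrix.sub_apply, Matrix.one_apply_eq,
      ← Matrix.replicateRow_vecMul, Matrix.replicateRow_mul_replicateCol_apply, ← dotProduct_mulVec]
  have hre := star_dotProduct_mulVec_eq_re hC.inv.posSemidef a
  constructor
  · intro h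
    have h0 := nonneg_of_posSemidef_unique h
    rw [hentry, hre, ← Complex.ofReal_one, ← Complex.ofReal_sub, Complex.zero_le_real] at h0
    linarith
  · intro h
    refine posSemidef_of_unique ?_
    rw [hentry, hre, ← Complex.ofReal_one, ← Complex.ofReal_sub, Complex.zero_le_real]
    linarith

/-- **Positive definiteness of a rank-one downdate.** For positive definite `C`,
`C - a a*` is positive definite iff `a* C⁻¹ a < 1`. [folklore] -/
theorem posDef_sub_vecMulVec_iff {C : Matrix n n ℂ} (hC : C.PosDef) (a : n → ℂ) :
    (C - vecMulVec a (star a)).PosDef ↔ (star a ⬝ᵥ C⁻¹ *ᵥ a).re < 1 := by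
  have hre := star_dotProduct_mulVec_eq_re hC.inv.posSemidef a
  constructor
  · intro h
    have hle := (posSemidef_sub_vecMulVec_iff hC a).1 h.posSemidef
    have hdet := (h.posSemidef.posDef_iff_det_ne_zero).1 h
    rw [det_sub_vecMulVec (isUnit_iff_ne_zero.2 hC.det_pos.ne'), mul_ne_zero_iff] at hdet
    have hne : (star a ⬝ᵥ C⁻¹ *ᵥ a).re ≠ 1 := by
      intro h1
      apply hdet.2
      rw [hre, h1, Complex.ofReal_one, sub_self]
    exact lt_of_le_of_ne hle hne
  · intro h
    have hpsd := (posSemidef_sub_vecMulVec_iff hC a).2 h.le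
    refine hpsd.posDef_iff_det_ne_zero.2 ?_
    rw [det_sub_vecMulVec (isUnit_iff_ne_zero.2 hC.det_pos.ne'), mul_ne_zero_iff]
    refine ⟨hC.det_pos.ne', ?_⟩
    rw [hre, ← Complex.ofReal_one, ← Complex.ofReal_sub, Complex.ofReal_ne_zero]
    linarith

omit [DecidableEq n] in
/-- A positive definite downdate `C - a a*` forces `C = (C - a a*) + a a*` to be positive
definite. [folklore] -/
theorem posDef_of_posDef_sub_vecMulVec {C : Matrix n n ℂ} {a : n → ℂ}
    (h : (C - vecMulVec a (star a)).PosDef) : C.PosDef := by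
  have := h.add_posSemidef (posSemidef_vecMulVec_self_star a)
  rwa [sub_add_cancel] at this

/-- **Determinant of a positive definite downdate**, real form: if `C` and `C - a a*` are positive
definite then `det (C - a a*) = det C · (1 - a* C⁻¹ a)` as real numbers. [folklore] -/
theorem det_re_sub_vecMulVec {C : Matrix n n ℂ} (hC : C.PosDef) (a : n → ℂ) :
    (C - vecMulVec a (star a)).det.re = C.det.re * (1 - (star a ⬝ᵥ C⁻¹ *ᵥ a).re) := by
  have h := det_sub_vecMulVec (isUnit_iff_ne_zero.2 hC.det_pos.ne') a
  rw [star_dotProduct_mulVec_eq_re hC.inv.posSemidef a] at h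
  rw [h]
  conv_lhs => rw [det_eq_re_of_posDef hC, ← Complex.ofReal_one, ← Complex.ofReal_sub,
    ← Complex.ofReal_mul, Complex.ofReal_re]

/-! ### The Gram complement of a tuple of vectors -/

/-- The **Gram complement** `1 - ∑ⱼ aⱼ aⱼ*` of a tuple of vectors `a₀, …, a_{q-1} ∈ ℂⁿ`
(`= 1 - A A*` for the matrix `A` with columns `aⱼ`). [folklore] -/
def oneSubGram {q : ℕ} (a : Fin q → n → ℂ) : Matrix n n ℂ :=
  1 - ∑ j, vecMulVec (a j) (star (a j))

omit [Fintype n] in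
/-- The Gram complement of the empty tuple is `1`. [folklore] -/
@[simp] theorem oneSubGram_zero (a : Fin 0 → n → ℂ) : oneSubGram a = 1 := by
  simp [oneSubGram]

omit [Fintype n] in
/-- Appending a vector downdates the Gram complement by `a a*`:
`1 - ∑_{j ≤ q} aⱼ aⱼ* = (1 - ∑_{j < q} aⱼ aⱼ*) - a_q a_q*`. [folklore] -/
theorem oneSubGram_snoc {q : ℕ} (a : Fin q → n → ℂ) (v : n → ℂ) :
    oneSubGram (Fin.snoc a v : Fin (q + 1) → n → ℂ) = oneSubGram a - vecMulVec v (star v) := by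
  simp only [oneSubGram, Fin.sum_univ_castSucc, Fin.snoc_castSucc, Fin.snoc_last]
  abel

omit [Fintype n] in
/-- The Gram complement is Hermitian. [folklore] -/
theorem isHermitian_oneSubGram {q : ℕ} (a : Fin q → n → ℂ) : (oneSubGram a).IsHermitian := by
  unfold oneSubGram
  refine IsHermitian.sub isHermitian_one ?_
  unfold IsHermitian
  rw [conjTranspose_sum]
  refine Finset.sum_congr rfl fun j _ => ?_
  rw [conjTranspose_vecMulVec, star_star]

omit [Fintype n] in
/-- The Gram complement as `1 - A A*` for the matrix `A` whose columns are the vectors.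
[folklore] -/
theorem oneSubGram_eq_one_sub_mul_conjTranspose {q : ℕ} (a : Fin q → n → ℂ) :
    oneSubGram a = 1 - (Matrix.of fun i j => a j i) * (Matrix.of fun i j => a j i)ᴴ := by
  unfold oneSubGram
  congr 1
  ext i k
  simp [Matrix.sum_apply, vecMulVec_apply, Matrix.mul_apply]

end Literature.LinearAlgebra.Matrix
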